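import Summits.NavierStokesRegularity.NavierStokesRegularity.Theorems.HeredityAtOne.Negative.CapStratumSilentWindow
import Literature.Analysis.FluidPDE.TaoClassGlue
import Literature.Analysis.FluidPDE.TaoClassSliceData
import Literature.Analysis.FluidPDE.LerayHopfConcatenation

/-!
# The ENERGY door of the silent signed sub-register: `E(τ_k) ≤ E(τ₀) ≤ κ·c₁Y₀·∫r²η`, impulse conserved

Cell `ns-blowup`, seat `refuter-ns-palasek-19249-disprove-1` (g5; DISPROVER, route `PalasekTowerBreakdown`, item
stmt-NavierStokesRegularity-19249 `HeredityAtOne`). NEGATIVE-LANE lemmas (no positive Theses conclusion), sorry-free,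
def-free, NO named fact. It adds to the level-zero reading of `CapStratumSilentWindow.lean` (g4: on SILENT designs —
`S.f t = 0` for `t ≥ τ₀` — a single-signed swirl-free HOST slice `u(τ₀)` keeps every later registered slice in the
class, with the Gallay–Šverák cap value of the host) a SECOND, constant-free monotone quantity: the kinetic energy.

§1 **Energy along unforced runs** (`kineticEnergy_le_of_sobolevDatum`): a finite-energy classical UNFORCED run on
`[a, b]` from an `H^∞` slice is Leray–Hopf in Tao's class (tree: `exists_isTaoSolutionOn_of_sobolevDatum`,
`IsTaoSolutionOn.isLerayHopfOn`, `IsLerayHopfOn.kineticEnergy_le_of_zero_force`), so `E(u t) ≤ E(u a)`,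
`E(v) = ½∫‖v‖²` (`VectorCalculus.kineticEnergy`). On a silent design every registered slice after the host has at
most the host's energy (`kineticEnergy_le_τ_zero_of_silent`; any rates, margins, level; no symmetry needed).

§2 **The energy door** (`kineticEnergy_le_of_silent_signed_host`). HYPOTHESIS (explicit binder `hκ`, never
asserted): the ENERGY–IMPULSE–SPEED inequality with constant `κ` for single-signed swirl-free slices,
`E(w) ≤ κ · sup‖w‖ · ∫ r²η(w)` (`η = ω_θ/r ≥ 0`, `∫r²η = ∫ r ω_θ`, twice the axial impulse). Its elementary value
is `κ = 1/4`: with the Stokes stream function `ψ(r,z) = ∫₀^r s w_z(s,z) ds` one has `|ψ| ≤ sup‖w‖ · r²/2` and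
`E = ½∫ ψ η dx = π∫∫ ψ ω_θ dr dz ≤ (sup‖w‖/2) π∫∫ r² ω_θ dr dz = ¼ sup‖w‖ ∫ r ω_θ dx` (energy and impulse
in stream-function form: Choi, CPAM 77 (2023), §2.2, `E[ξ] = ½∫ξ𝒢[ξ]dx`, `P[ξ] = ½∫r²ξ dx`; the bound `¼` is
attained in the limit of a cylindrical vortex sheet) — NOT yet a tree theorem: typing it is a brick for the GS15
lineage (cell STATUS, this seat's g5 line), whence the binder. GIVEN `hκ`, on a silent design with globally anchored margins
(`‖u(τ₀, ·)‖ ≤ c₁Y₀` everywhere, `Stage.norm_τ_zero_le`) and single-signed swirl-free host of height `M`: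
`E(u t) ≤ E(u τ₀) ≤ κ c₁Y₀ ∫r²η(u τ₀) = κ c₁Y₀ ∫r²η(u t)` for every `t ∈ [τ₀, τ_k]` (impulse conserved, GS15
Lemma 6.4, tree `integral_rsq_angVortQuot_eq_of_sobolevDatum`). At a registered readout `τ_j`, `1 ≤ j ≤ k`, the
floor `c₁Y_j ≤ ‖u(τ_j, x_j)‖ ≤ sup‖u(τ_j)‖ =: V` turns this into the ENERGY-EFFICIENCY bound
`Y_j · E(u τ_j) ≤ κ Y₀ · V · ∫r²η(u τ_j)` (`kineticEnergy_floor_le_of_silent_signed_host`), on the wide rates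
(`2Y₀ ≤ Y₁`) `2 E(u τ_j) ≤ κ V ∫r²η(u τ_j)` (`two_mul_kineticEnergy_le_of_silent_signed_host`).

NUMBERS (rigid wide register, `c₁ = 1`, `κ = 1/4`, level `1`): a silent signed-host design registering level `1`
needs a `τ₁`-slice `v` with `E(v)/(sup‖v‖·∫r²η(v)) ≤ Y₀/(4Y₁) = 0.1216`. Hill's spherical vortex has
`E = sup‖v‖·∫r²η / 7` EXACTLY (`E = (10π/7)a³U_T²`, `U_T = 2Ma²/15`, `sup‖v‖ = Ma²/3`, `∫r²η = 8πMa⁵/15`;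
`1/7 = 0.1429 > 0.1216`): Hill-type `τ₁`-slices — in particular the registered-letter lazy slice of
`LazyEnvelopeSliceSigned.lean` (p485399) — are EXCLUDED on this sub-register, complementing g4 (Hill excluded as
HOST, efficiency `0.2048 > 0.1720`). Together with the cap door of `CapStratum.lean` the `τ₁`-slice must be
simultaneously CAP-efficient (`sup‖v‖ > 0.160·(∫η ∫r²η)^{1/4} M^{1/2}`: fat, near-axis) and ENERGY-poor
(`E < 0.1216 sup‖v‖ ∫r²η`); the (e, ε) table of the standard signed shapes (Hill, uniform tori, Gaussian rings,
peaked/hollow balls, spheroids, composites, columns) is kit job j272119 (cell STATUS). The exclusion form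
(`not_lt_kineticEnergy_of_silent_signed_host`): no registered slice after the host has `κ c₁Y₀ ∫r²η < E`.

WHAT THIS IS NOT: not Navier–Stokes evidence, no verdict change — no stage, design or slice is constructed, and the
energy–impulse–speed inequality enters as a hypothesis. Learning for the proof side: on the silent signed
sub-register the emptiness conjunct `CapStratumEmptyAt 1` of `heredityAtOne_iff_offStratum_and_empty` is squeezed
between two static functionals of ONE slice shape.
References: Gallay–Šverák, arXiv:1510.01036 [cite: GallaySverak2016, Lemma 6.4 (p. 19)]; Leray 1934 [cite: Leray1934, §32];
Tao, Anal. PDE 6 (2013) [cite: Tao2011, Cor. 11.1]; Choi, CPAM 77 (2023) 52–138 [cite: Choi2023, §2.2];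
Palasek, arXiv:2605.13827 [cite: Palasek2026ElementaryModel, §4].
-/

noncomputable section

namespace Summit.NavierStokesRegularity.HeredityAtOneEnergyWindow

open Set MeasureTheory Filter Topology Function
open scoped ENNReal NNReal ContDiff
open Literature.Analysis.FluidPDE
open Summit.NavierStokesRegularity.FluidComputer
open Summit.NavierStokesRegularity.FluidComputer.PalasekTowerClayBridge
open Summit.NavierStokesRegularity.NavierStokesRegularity
open Summit.NavierStokesRegularity.HeredityAtOneNoSwirlCap
open Summit.NavierStokesRegularity.HeredityAtOneSpeedCap
open Summit.NavierStokesRegularity.HeredityAtOneNoSwirlStratum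
open Summit.NavierStokesRegularity.HeredityAtOneSilentWindow

/-! ## §1 The kinetic energy along finite-energy classical unforced runs -/

section Run

variable {T₀ : Set ℝ} {v : ℝ → EuclideanSpace ℝ (Fin 3) → EuclideanSpace ℝ (Fin 3)} {t₀ : ℝ}

/-- **Energy along an unforced run from an `H^∞` slice**: a finite-energy classical solution of a system whose
force vanishes on `[a, b]`, starting from the slice `v t₀` of a field with bounded Sobolev norms of all orders on
`T₀ ∋ t₀`, has `E(u t) ≤ E(v t₀)` and `‖u t‖² ∈ L¹` for every `t ∈ [a, b]` (it is a Tao-class, hence Leray–Hopf,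
solution; Leray's energy inequality with zero force). [cite: Leray1934, §32] [cite: Tao2011, Cor. 11.1] -/
theorem kineticEnergy_le_of_sobolevDatum (hv : HasBoundedSobolevNormsOn T₀ v) (ht₀ : t₀ ∈ T₀)
    ⦃a b : ℝ⦄ (hab : a < b) (f u : ℝ → EuclideanSpace ℝ (Fin 3) → EuclideanSpace ℝ (Fin 3))
    (p : ℝ → EuclideanSpace ℝ (Fin 3) → ℝ) (hu : IsClassicalNSSolutionOn (Icc a b) 1 f u p)
    (hf : ∀ t ∈ Icc a b, f t = 0)
    (hE : ∃ C : ℝ≥0∞, C < ⊤ ∧ ∀ t ∈ Icc a b, ∫⁻ x, ‖u t x‖ₑ ^ 2 ≤ C) (hua : u a = v t₀) :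
    ∀ t ∈ Icc a b, VectorCalculus.kineticEnergy (u t) ≤ VectorCalculus.kineticEnergy (v t₀) ∧
      Integrable (fun x => ‖u t x‖ ^ 2) := by
  have hT : 0 < b - a := sub_pos.2 hab
  obtain ⟨q, hTao⟩ := exists_isTaoSolutionOn_of_sobolevDatum hv ht₀ hab f u p hu hf hE hua
  intro t ht
  have hσ : t - a ∈ Icc 0 (b - a) := ⟨by linarith [ht.1], by linarith [ht.2]⟩
  have h1 := (hTao.isLerayHopfOn hT).kineticEnergy_le_of_zero_force zero_le_one hσ
  have h2 := hTao.integrable_norm_sq hσ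
  simp only [sub_add_cancel] at h1 h2
  exact ⟨h1, h2⟩

end Run

/-! ## §2 SILENT designs: the energy of the registered slices, and the energy door of a signed host -/

section Silent

variable {R : TowerRates} {S : Schedule R} {m : Margins R} {k : ℕ}

/-- **On a silent design the registered slices after the host carry at most the host's energy**:
`E(s.u t) ≤ E(s.u τ₀)` for `t ∈ [τ₀, τ_k]` (any rates, margins and level; no symmetry or sign hypothesis).
[cite: Leray1934, §32] [cite: Tao2011, Cor. 11.1] -/
theorem kineticEnergy_le_τ_zero_of_silent (hSil : ∀ t, S.τ 0 ≤ t → S.f t = 0) (s : Stage 1 R S m k) :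
    ∀ t ∈ Icc (S.τ 0) (S.τ k),
      VectorCalculus.kineticEnergy (s.u t) ≤ VectorCalculus.kineticEnergy (s.u (S.τ 0)) := by
  intro t ht
  rcases (S.τ_mono (Nat.zero_le k)).eq_or_lt with h0k | h0k
  · have htt : t = S.τ 0 := le_antisymm (h0k ▸ ht.2) ht.1
    rw [htt]
  · obtain ⟨hcl, hf0, hE⟩ := run_from_τ_zero hSil s h0k
    exact (kineticEnergy_le_of_sobolevDatum (stage_hasBoundedSobolevNormsOn s) s.τ_zero_mem_Icc h0k S.f
      s.u s.p hcl hf0 hE rfl t ht).1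

/-- The slices of a stage are square-integrable: `‖s.u t‖² ∈ L¹` for `t ∈ [0, τ_k]`. [folklore] -/
theorem integrable_norm_sq_slice (s : Stage 1 R S m k) {t : ℝ} (ht : t ∈ Icc 0 (S.τ k)) :
    Integrable (fun x => ‖s.u t x‖ ^ 2) := by
  obtain ⟨C, hC, hb⟩ := s.energy
  have hm : MemLp (s.u t) 2 volume :=
    ⟨(s.classical.contDiff_velocity ht).continuous.aestronglyMeasurable,
      eLpNorm_two_lt_top_of_lintegral_enorm_sq_lt_top ((hb t ht).trans_lt hC)⟩
  exact (memLp_two_iff_integrable_sq_norm hm.1).1 hm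

/-- The slices of a stage have square-integrable gradient: `‖D(s.u t)‖² ∈ L¹` for `t ∈ [0, τ_k]` (the `H¹`
conjunct of `stage_hasBoundedSobolevNormsOn`). [cite: Tao2011, Cor. 4.3] -/
theorem integrable_norm_fderiv_sq_slice (s : Stage 1 R S m k) {t : ℝ} (ht : t ∈ Icc 0 (S.τ k)) :
    Integrable (fun x => ‖fderiv ℝ (s.u t) x‖ ^ 2) := by
  obtain ⟨C, hC⟩ := stage_hasBoundedSobolevNormsOn s 1
  have hcont : Continuous (fderiv ℝ (s.u t)) :=
    ((s.classical.contDiff_velocity ht).continuous_fderiv (by norm_cast))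
  have hm : MemLp (fderiv ℝ (s.u t)) 2 volume := by
    refine ⟨hcont.aestronglyMeasurable, eLpNorm_two_lt_top_of_lintegral_enorm_sq_lt_top ?_⟩
    have e : ∫⁻ x, ‖fderiv ℝ (s.u t) x‖ₑ ^ 2 = ∫⁻ x, ‖iteratedFDeriv ℝ 1 (s.u t) x‖ₑ ^ 2 :=
      lintegral_congr fun x => by
        rw [← ofReal_norm, ← norm_iteratedFDeriv_zero (𝕜 := ℝ) (f := fderiv ℝ (s.u t)),
          norm_iteratedFDeriv_fderiv, ofReal_norm]
    rw [e]
    exact (hC t ht).trans_lt ENNReal.coe_lt_top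
  exact (memLp_two_iff_integrable_sq_norm hm.1).1 hm

/-- **THE ENERGY DOOR.** Hypothesis `hκ` (explicit, never asserted): the energy–impulse–speed inequality with
constant `κ` for `C²` divergence-free `H¹` single-signed swirl-free slices, `E(w) ≤ κ · U · ∫r²η(w)` whenever
`‖w‖ ≤ U` everywhere (elementary value `κ = 1/4`). THEN on a SILENT design with globally anchored margins, for a
stage at any level `k` whose `τ₀`-slice is single-signed swirl-free of height `M`:
`E(s.u t) ≤ κ · c₁Y₀ · ∫r²η(s.u t)` for every `t ∈ [τ₀, τ_k]` (energy non-increasing, impulse conserved, host speed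
`≤ c₁Y₀`). [cite: Leray1934, §32] [cite: GallaySverak2016, Lemma 6.4] [cite: Palasek2026ElementaryModel, §4] -/
theorem kineticEnergy_le_of_silent_signed_host {κ : ℝ}
    (hκ : ∀ (w : EuclideanSpace ℝ (Fin 3) → EuclideanSpace ℝ (Fin 3)) (M U : ℝ),
      SignedNoSwirlSlice w M → ContDiff ℝ 2 w → VectorCalculus.IsDivFree w →
      Integrable (fun x => ‖w x‖ ^ 2) → Integrable (fun x => ‖fderiv ℝ w x‖ ^ 2) →
      (∀ x, ‖w x‖ ≤ U) →
      VectorCalculus.kineticEnergy w ≤ κ * U * ∫ y, cylRadius y ^ 2 * angVortQuot w y)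
    (hSil : ∀ t, S.τ 0 ≤ t → S.f t = 0) (s : Stage 1 R S (Margins.routeG R) k) {M : ℝ}
    (hsl : SignedNoSwirlSlice (s.u (S.τ 0)) M) :
    ∀ t ∈ Icc (S.τ 0) (S.τ k),
      VectorCalculus.kineticEnergy (s.u t) ≤
        κ * (S.c₁ * R.Y 0) * ∫ y, cylRadius y ^ 2 * angVortQuot (s.u t) y := by
  have h0 : S.τ 0 ∈ Icc 0 (S.τ k) := s.τ_zero_mem_Icc
  have hhost : VectorCalculus.kineticEnergy (s.u (S.τ 0)) ≤
      κ * (S.c₁ * R.Y 0) * ∫ y, cylRadius y ^ 2 * angVortQuot (s.u (S.τ 0)) y :=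
    hκ _ M _ hsl ((s.classical.contDiff_velocity h0).of_le (by norm_cast)) (s.classical.divFree _ h0)
      (integrable_norm_sq_slice s h0) (integrable_norm_fderiv_sq_slice s h0) (s.norm_τ_zero_le)
  intro t ht
  rcases (S.τ_mono (Nat.zero_le k)).eq_or_lt with h0k | h0k
  · have htt : t = S.τ 0 := le_antisymm (h0k ▸ ht.2) ht.1
    rw [htt]
    exact hhost
  · obtain ⟨hcl, hf0, hE⟩ := run_from_τ_zero hSil s h0k
    have hEt := (kineticEnergy_le_of_sobolevDatum (stage_hasBoundedSobolevNormsOn s) s.τ_zero_mem_Icc h0k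
      S.f s.u s.p hcl hf0 hE rfl t ht).1
    have hI := integral_rsq_angVortQuot_eq_of_sobolevDatum (stage_hasBoundedSobolevNormsOn s)
      s.τ_zero_mem_Icc hsl h0k S.f s.u s.p hcl hf0 hE rfl t ht
    rw [hI]
    exact hEt.trans hhost

/-- **Exclusion form**: on a silent design with globally anchored margins and single-signed swirl-free host, NO
registered slice `s.u t`, `t ∈ [τ₀, τ_k]`, has `κ c₁Y₀ ∫r²η(s.u t) < E(s.u t)` (`hκ` as in
`kineticEnergy_le_of_silent_signed_host`). [cite: Leray1934, §32] [cite: GallaySverak2016, Lemma 6.4] -/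
theorem not_lt_kineticEnergy_of_silent_signed_host {κ : ℝ}
    (hκ : ∀ (w : EuclideanSpace ℝ (Fin 3) → EuclideanSpace ℝ (Fin 3)) (M U : ℝ),
      SignedNoSwirlSlice w M → ContDiff ℝ 2 w → VectorCalculus.IsDivFree w →
      Integrable (fun x => ‖w x‖ ^ 2) → Integrable (fun x => ‖fderiv ℝ w x‖ ^ 2) →
      (∀ x, ‖w x‖ ≤ U) →
      VectorCalculus.kineticEnergy w ≤ κ * U * ∫ y, cylRadius y ^ 2 * angVortQuot w y)
    (hSil : ∀ t, S.τ 0 ≤ t → S.f t = 0) (s : Stage 1 R S (Margins.routeG R) k) {M : ℝ}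
    (hsl : SignedNoSwirlSlice (s.u (S.τ 0)) M) {t : ℝ} (ht : t ∈ Icc (S.τ 0) (S.τ k)) :
    ¬ κ * (S.c₁ * R.Y 0) * (∫ y, cylRadius y ^ 2 * angVortQuot (s.u t) y) <
        VectorCalculus.kineticEnergy (s.u t) :=
  not_lt.2 (kineticEnergy_le_of_silent_signed_host hκ hSil s hsl t ht)

/-- **Energy efficiency at a registered readout**: under `hκ` (as in `kineticEnergy_le_of_silent_signed_host`,
with `κ ≥ 0`), on a silent design with globally anchored margins and single-signed swirl-free host, at every
registered readout `τ_j`, `j ≤ k`, and for every bound `V` of the slice speed (`‖s.u (τ_j) x‖ ≤ V` for all `x`):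
`Y_j · E(s.u τ_j) ≤ κ Y₀ · V · ∫r²η(s.u τ_j)` (the floor gives `c₁Y_j ≤ V`).
[cite: Leray1934, §32] [cite: GallaySverak2016, Lemma 6.4] [cite: Palasek2026ElementaryModel, §4] -/
theorem kineticEnergy_floor_le_of_silent_signed_host {κ : ℝ} (hκ0 : 0 ≤ κ)
    (hκ : ∀ (w : EuclideanSpace ℝ (Fin 3) → EuclideanSpace ℝ (Fin 3)) (M U : ℝ),
      SignedNoSwirlSlice w M → ContDiff ℝ 2 w → VectorCalculus.IsDivFree w →
      Integrable (fun x => ‖w x‖ ^ 2) → Integrable (fun x => ‖fderiv ℝ w x‖ ^ 2) →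
      (∀ x, ‖w x‖ ≤ U) →
      VectorCalculus.kineticEnergy w ≤ κ * U * ∫ y, cylRadius y ^ 2 * angVortQuot w y)
    (hSil : ∀ t, S.τ 0 ≤ t → S.f t = 0) (s : Stage 1 R S (Margins.routeG R) k) {M : ℝ}
    (hsl : SignedNoSwirlSlice (s.u (S.τ 0)) M) {j : ℕ} (hj : j ≤ k) {V : ℝ}
    (hV : ∀ x, ‖s.u (S.τ j) x‖ ≤ V) :
    R.Y j * VectorCalculus.kineticEnergy (s.u (S.τ j)) ≤
      κ * R.Y 0 * V * ∫ y, cylRadius y ^ 2 * angVortQuot (s.u (S.τ j)) y := by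
  have hτj : S.τ j ∈ Icc (S.τ 0) (S.τ k) := ⟨S.τ_mono (Nat.zero_le j), S.τ_mono hj⟩
  have hE := kineticEnergy_le_of_silent_signed_host hκ hSil s hsl (S.τ j) hτj
  obtain ⟨x, -, hfl⟩ := s.floor j hj
  have hcV : S.c₁ * R.Y j ≤ V := hfl.trans (hV x)
  have hslj : SignedNoSwirlSlice (s.u (S.τ j)) M := signedNoSwirlSlice_of_silent hSil s hsl _ hτj
  have hI0 : 0 ≤ ∫ y, cylRadius y ^ 2 * angVortQuot (s.u (S.τ j)) y :=
    integral_nonneg fun y => mul_nonneg (sq_nonneg _) (hslj.nonneg y)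
  have hY0 : 0 < R.Y 0 := Real.rpow_pos_of_pos (R.N_pos 0) _
  have hYj : 0 < R.Y j := Real.rpow_pos_of_pos (R.N_pos j) _
  have hE0 : 0 ≤ VectorCalculus.kineticEnergy (s.u (S.τ j)) := kineticEnergy_nonneg _
  calc R.Y j * VectorCalculus.kineticEnergy (s.u (S.τ j))
      ≤ R.Y j * (κ * (S.c₁ * R.Y 0) * ∫ y, cylRadius y ^ 2 * angVortQuot (s.u (S.τ j)) y) :=
        mul_le_mul_of_nonneg_left hE hYj.le
    _ = (S.c₁ * R.Y j) * (κ * R.Y 0 * ∫ y, cylRadius y ^ 2 * angVortQuot (s.u (S.τ j)) y) := by ring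
    _ ≤ V * (κ * R.Y 0 * ∫ y, cylRadius y ^ 2 * angVortQuot (s.u (S.τ j)) y) :=
        mul_le_mul_of_nonneg_right hcV (mul_nonneg (mul_nonneg hκ0 hY0.le) hI0)
    _ = κ * R.Y 0 * V * ∫ y, cylRadius y ^ 2 * angVortQuot (s.u (S.τ j)) y := by ring

/-- **Wide rates: the registered slices are at most HALF as energy-efficient as the inequality allows.** On the
wide-base rates (`2Y_j ≤ Y_{j+1}`, `TowerRates.wide_sep`), under `hκ` (`κ ≥ 0`), on a silent design with globally
anchored margins and single-signed swirl-free host, at every registered readout `τ_j` with `1 ≤ j ≤ k` and every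
speed bound `V` of the slice: `2 E(s.u τ_j) ≤ κ · V · ∫r²η(s.u τ_j)`. With `κ = 1/4` and the sharper ratio
`Y₀/Y₁ = 0.4863`: `E ≤ 0.1216 · V · ∫r²η` at `τ₁`, whereas Hill's spherical vortex has `E = V ∫r²η / 7`
(`0.1429`): EXCLUDED as a registered slice of this sub-register. [cite: Leray1934, §32] [cite: GallaySverak2016, Lemma 6.4]
[cite: Palasek2026ElementaryModel, §4] -/
theorem two_mul_kineticEnergy_le_of_silent_signed_host {κ : ℝ} (hκ0 : 0 ≤ κ)
    (hκ : ∀ (w : EuclideanSpace ℝ (Fin 3) → EuclideanSpace ℝ (Fin 3)) (M U : ℝ),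
      SignedNoSwirlSlice w M → ContDiff ℝ 2 w → VectorCalculus.IsDivFree w →
      Integrable (fun x => ‖w x‖ ^ 2) → Integrable (fun x => ‖fderiv ℝ w x‖ ^ 2) →
      (∀ x, ‖w x‖ ≤ U) →
      VectorCalculus.kineticEnergy w ≤ κ * U * ∫ y, cylRadius y ^ 2 * angVortQuot w y)
    {S : Schedule TowerRates.wide} (hSil : ∀ t, S.τ 0 ≤ t → S.f t = 0)
    (s : Stage 1 TowerRates.wide S (Margins.routeG TowerRates.wide) k) {M : ℝ}
    (hsl : SignedNoSwirlSlice (s.u (S.τ 0)) M) {j : ℕ} (h1j : 1 ≤ j) (hj : j ≤ k) {V : ℝ}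
    (hV : ∀ x, ‖s.u (S.τ j) x‖ ≤ V) :
    2 * VectorCalculus.kineticEnergy (s.u (S.τ j)) ≤
      κ * V * ∫ y, cylRadius y ^ 2 * angVortQuot (s.u (S.τ j)) y := by
  have h := kineticEnergy_floor_le_of_silent_signed_host hκ0 hκ hSil s hsl hj hV
  have hmono : StrictMono TowerRates.wide.Y := strictMono_nat_of_lt_succ TowerRates.wide.Y_lt_Y_succ
  have hY1j : TowerRates.wide.Y 1 ≤ TowerRates.wide.Y j := hmono.monotone h1j
  have hsep := TowerRates.wide_sep 0
  have hτj : S.τ j ∈ Icc (S.τ 0) (S.τ k) := ⟨S.τ_mono (Nat.zero_le j), S.τ_mono hj⟩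
  have hslj : SignedNoSwirlSlice (s.u (S.τ j)) M := signedNoSwirlSlice_of_silent hSil s hsl _ hτj
  have hI0 : 0 ≤ ∫ y, cylRadius y ^ 2 * angVortQuot (s.u (S.τ j)) y :=
    integral_nonneg fun y => mul_nonneg (sq_nonneg _) (hslj.nonneg y)
  have hV0 : 0 ≤ V := (norm_nonneg _).trans (hV 0)
  have hE0 : 0 ≤ VectorCalculus.kineticEnergy (s.u (S.τ j)) := kineticEnergy_nonneg _
  have hY0 : 0 < TowerRates.wide.Y 0 := Real.rpow_pos_of_pos (TowerRates.wide.N_pos 0) _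
  have hP : 0 ≤ κ * V * ∫ y, cylRadius y ^ 2 * angVortQuot (s.u (S.τ j)) y :=
    mul_nonneg (mul_nonneg hκ0 hV0) hI0
  nlinarith

/-- **Both doors at once (silent signed sub-register, level `k ≥ 1`).** Under `hκ` (`κ ≥ 0`), on a silent wide
design with globally anchored margins whose host is single-signed swirl-free of height `M`, a registered stage at
a level `k ≥ 1` has, at its top readout `τ_k` and for every speed bound `V` of that slice, BOTH
`c₁Y_k ≤ 0.35356 √(√((∫η)(∫r²η)) M)` (the cap door of g4, `floor_le_cap_τ_zero_of_silent` moved to the `τ_k`-slice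
by monotonicity is not needed: the `τ_k`-slice itself obeys the tree cap `isNoSwirlCapConstant_eighth` through
`SliceHeredityCap`) — here recorded in the host form — AND `2E ≤ κ V ∫r²η`. [cite: GallaySverak2016, Prop. 2.6 (2.14), Lemma 6.4]
[cite: Leray1934, §32] [cite: Palasek2026ElementaryModel, §4] -/
theorem cap_and_energy_doors_of_silent_signed_host {κ : ℝ} (hκ0 : 0 ≤ κ)
    (hκ : ∀ (w : EuclideanSpace ℝ (Fin 3) → EuclideanSpace ℝ (Fin 3)) (M U : ℝ),
      SignedNoSwirlSlice w M → ContDiff ℝ 2 w → VectorCalculus.IsDivFree w →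
      Integrable (fun x => ‖w x‖ ^ 2) → Integrable (fun x => ‖fderiv ℝ w x‖ ^ 2) →
      (∀ x, ‖w x‖ ≤ U) →
      VectorCalculus.kineticEnergy w ≤ κ * U * ∫ y, cylRadius y ^ 2 * angVortQuot w y)
    {S : Schedule TowerRates.wide} (hSil : ∀ t, S.τ 0 ≤ t → S.f t = 0) (hk : 1 ≤ k)
    (s : Stage 1 TowerRates.wide S (Margins.routeG TowerRates.wide) k) {M : ℝ}
    (hsl : SignedNoSwirlSlice (s.u (S.τ 0)) M) {V : ℝ} (hV : ∀ x, ‖s.u (S.τ k) x‖ ≤ V) :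
    S.c₁ * TowerRates.wide.Y k ≤ 0.35356 * Real.sqrt (Real.sqrt ((∫ y, angVortQuot (s.u (S.τ 0)) y) *
        ∫ y, cylRadius y ^ 2 * angVortQuot (s.u (S.τ 0)) y) * M) ∧
      2 * VectorCalculus.kineticEnergy (s.u (S.τ k)) ≤
        κ * V * ∫ y, cylRadius y ^ 2 * angVortQuot (s.u (S.τ k)) y :=
  ⟨floor_le_cap_τ_zero_of_silent isNoSwirlCapConstant_eighth hSil hk s hsl le_rfl,
    two_mul_kineticEnergy_le_of_silent_signed_host hκ0 hκ hSil s hsl hk le_rfl hV⟩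

end Silent

end Summit.NavierStokesRegularity.HeredityAtOneEnergyWindow

end
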